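import Literature.NumberTheory.Sieve.DrappeauDispersion

/-!
LANDING NOTE (typer ls-idea-typ-1 gen 1, cell ls-idea): authored by seat ls-idea-lens-4 gen 2 (sketch
`Sketch_K45.lean` sha16 4de2a1d9222e4b3b, rc 0; card K4-5, critics A PASS (producer-line location) ·
B PASS · C PASS-structure with the tree-label FIX applied below: ABL Thm 2.3 at `a = 1` is the tree's
`AssingBlomerLi2020_theorem23`, Drappeau Thm 5.1 is PROVED modulo it). ONE NAMED FACT (D-0014), rendered
exactly like the tree's `Drappeau2017_theorem51` (same kernel `Drappeau2017.uR`, same `BFI.dyadic`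
blocks, same divisor-bounded coefficient classes); not proved here. «The programme SEARCHES and TYPES;
no claim about Landau–Siegel zeros, Theorems 1–2 of arXiv:2211.02515 or a repaired Margin232 until a
kernel theorem says so.»

## References
* [AssingBlomerLi2020] E. Assing, V. Blomer, J. Li, *Uniform Titchmarsh divisor problems*,
  arXiv:2005.13915 (Adv. Math. 2021), Proposition 4.1, p. 17 L21–L31.
  [held: paper:arxiv-2005.13915-gx53931060 p0017]
* [Drappeau2017] S. Drappeau, Proc. LMS 114 (2017), Thm 5.1 (the `|a₁| ≤ x^δ` prototype; tree
  `Drappeau2017_theorem51`).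

# Assing–Blomer–Li's uniform Type-II estimate with Drappeau's kernel `𝔲_R` and a LONG residue range
# `|a₁| ≤ x^{1+δ}` (Proposition 4.1) — the printed Type-II input of card K4-5's crux K1

The analogue of `Drappeau2017_theorem51` with (i) the long range `|a₁| ≤ x^{1+δ}` for the residue
parameter, (ii) an extra congruence `q ≡ c₀ (mod c)` on the modulus, (iii) the power saving `R⁻¹`
against a `c·x (log x)^D` main size. «Sufficiently small η» is NOT monotone here (the range
`x^η ≤ N ≤ x^{1/4+η}` widens with `η`), hence the explicit `η₀`; `q ∼ Q` is rendered by `BFI.dyadic`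
(`Q < q ≤ 2Q`; the paper prints `Q ≤ q ≤ 2Q` and smooths the `q`-sum); the signed `≪_{η,A}` as a norm
bound with `∃ C D x₀` (the `∃ x₀` weakens the printed uniformity in `x`). A named fact; users take
`(h : AssingBlomerLi2020_proposition41)`.
-/

noncomputable section

namespace Literature.NumberTheory.Sieve

open scoped ArithmeticFunction.sigma
open Drappeau2017

/-- **Assing–Blomer–Li 2021, Proposition 4.1** (arXiv:2005.13915, p. 17): "Let `M, N, Q, R ≥ 1`,
`a₁, a₂ ∈ ℤ ∖ {0}`, write `x = MN`. Let `c ∈ ℕ`, `c₀ ∈ ℤ` with `(c₀, c) = 1`. Let `α_m` and `β_n` be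
two sequences supported in `m ∈ (M, 2M]` and `n ∈ (N, 2N]` such that `α_m ≤ τ(m)^A`, `β_n ≤ τ(n)^A`
for some `A ≥ 1`. Let `η > 0` be any sufficiently small number. Then there exist `δ = δ(η) > 0` and
`D = D(η, A)` with the following property. If `x^η ≤ N ≤ x^{1/4+η}`, `Q ≤ x^{1/2+δ}`,
`c, R, |a₂| ≤ x^δ`, `|a₁| ≤ x^{1+δ}` then
`∑_{Q ≤ q ≤ 2Q, (q,a₁a₂)=1, q ≡ c₀ (mod c)} ∑_{m,n, (n,a₂)=1} α_m β_n u_R(mn ā₁ a₂; q)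
≪_{η,A} c x (log x)^D R^{−1}`." ("an analogue of [Dr, Theorem 5.1] with a longer range for `a₁` and
an additional congruence condition on `q`.") Rendering as for `Drappeau2017_theorem51`; `∃ x₀` weakens
the printed uniformity in `x`. Deep theorem (dispersion + the paper's Theorem 2.3 on sums of
Kloosterman sums with large `a`); users take `(h : AssingBlomerLi2020_proposition41)`.
In tree terms (ref-C 20:11:25Z label fix): ABL Theorem 2.3 at `a = 1` is the named fact
`AssingBlomerLi2020_theorem23` (KloostermanQuintilinearCongruences.lean) and Drappeau's Theorem 5.1 is
PROVED modulo it (`Drappeau2017_theorem51_of_ABL23`, the `DrappeauDispersion*.lean` chain, ≈ 25 kLoC);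
Proposition 4.1 = the same §5 machinery with Theorem 2.3 for GENERAL `a` (the `a`-aspect terms of `K`,
absent at `a = 1`) — so the honest proof path is: type `AssingBlomerLi2020_theorem23` with the
`a`-dependence, then port ABL §4's modifications of [Dr, §5.2–5.4] onto the existing chain. Untyped so far
(bib key `AssingBlomerLi2020` exists in the tree).
[cite: AssingBlomerLi2020, Proposition 4.1] -/
def AssingBlomerLi2020_proposition41 : Prop :=
  ∃ η₀ : ℝ, 0 < η₀ ∧ ∀ η : ℝ, 0 < η → η ≤ η₀ → ∃ δ : ℝ, 0 < δ ∧ ∀ Aτ : ℝ, 0 ≤ Aτ →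
    ∃ C D x₀ : ℝ, ∀ x : ℝ, x₀ ≤ x →
    ∀ M N S Rd : ℝ, 1 ≤ M → 1 ≤ N → M * N = x → x ^ η ≤ N → N ≤ x ^ (1 / 4 + η) →
      1 ≤ S → S ≤ x ^ (1 / 2 + δ) → 1 ≤ Rd → Rd ≤ x ^ δ →
    ∀ c : ℕ, 1 ≤ c → (c : ℝ) ≤ x ^ δ → ∀ c₀ : ℤ, IsCoprime c₀ (c : ℤ) →
    ∀ a₁ a₂ : ℤ, a₁ ≠ 0 → a₂ ≠ 0 → (|a₁| : ℝ) ≤ x ^ (1 + δ) → (|a₂| : ℝ) ≤ x ^ δ →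
    ∀ α β : ℕ → ℂ, (∀ m, ‖α m‖ ≤ (σ 0 m : ℝ) ^ Aτ) → (∀ n, ‖β n‖ ≤ (σ 0 n : ℝ) ^ Aτ) →
      ‖∑ s ∈ (BFI.dyadic S).filter
            (fun s : ℕ => IsCoprime (s : ℤ) (a₁ * a₂) ∧ ((s : ℤ) : ZMod c) = (c₀ : ZMod c)),
          ∑ m ∈ BFI.dyadic M, ∑ n ∈ (BFI.dyadic N).filter (fun n : ℕ => IsCoprime (n : ℤ) a₂),
            α m * β n *
              uR Rd s (((m * n : ℕ) : ZMod s) * ((a₁ : ZMod s))⁻¹ * ((a₂ : ZMod s)))‖ ≤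
        C * c * x * Real.log x ^ D / Rd

end Literature.NumberTheory.Sieve

end
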